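import Summits.Ventures.PercRepro.DFSWitness
import Summits.Ventures.PercRepro.DecisionTreeCS
import Summits.Ventures.PercRepro.Benchmarks

/-!
# Gladkov's Theorem 6.2, inequality (14): `P(abc)² ≤ 2 · P(ab ∪ ac)² · P(bc)`

Gladkov (arXiv:2408.08457, §6.2) for a finite multigraph and three vertices `a`, `b`, `c`:
let `T` be the DFS decision tree from `a` that sends every edge to `S` and stops at `b` or `c`
(`MultiGraph.dfs`, `DFSTree.lean`).  It decides `ab ∪ ac` (`DFSGood.lean`), so Theorem 5.2
(`DTree.cauchy_schwarz`, with `T` as its own continuation) gives the lower bound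
`P(abc)² ≤ P(ab ∪ ac) · P(ω ∈ abc ∧ ω →_S ω' ∈ abc)`.  At every leaf the pair with both
configurations in `abc` lies in `(ab ∪ ac) □_S bc ∪ bc □_S (ab ∪ ac)` (`disjOcc_of_leafState`,
`DFSWitness.lean`), and Theorem 4.3 (`DTree.vdbk`) bounds each disjoint occurrence by the
product of the probabilities: `P(ω ∈ abc ∧ ω →_S ω' ∈ abc) ≤ 2 · P(ab ∪ ac) · P(bc)`.
Together: `P(abc)² ≤ 2 · P(ab ∪ ac)² · P(bc)` for distinct marks (`gladkov_thm62_of_ne`); the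
degenerate markings are immediate, giving typer-2's benchmark `Gladkov24Thm62`
(`Gladkov24Thm62_holds`).
-/

namespace PercRepro

open Finset

/-- Every tree continues itself. -/
theorem DTree.continues_refl {E : Type*} : ∀ t : DTree E, DTree.Continues t t
  | .leaf => trivial
  | .node _ _ next => ⟨rfl, rfl, fun b b' => DTree.continues_refl (next b b')⟩

namespace MultiGraph

variable {V E : Type*} {G : MultiGraph V E}

/-- Reaching `{b, c}` from `a` is `ab ∪ ac`. -/
theorem reachEvent_pair [DecidableEq V] (a b c : V) :
    G.reachEvent a {b, c} = G.connEvent a b ∪ G.connEvent a c := by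
  ext ω
  simp only [reachEvent, Set.mem_setOf_eq, Finset.mem_insert, Finset.mem_singleton, Set.mem_union,
    mem_connEvent]
  constructor
  · rintro ⟨t, (rfl | rfl), h⟩
    · exact Or.inl h
    · exact Or.inr h
  · rintro (h | h)
    · exact ⟨b, Or.inl rfl, h⟩
    · exact ⟨c, Or.inr rfl, h⟩

variable [Fintype E] [DecidableEq E]

/-- **Gladkov's Theorem 6.2, inequality (14), for distinct marks**:
`P(abc)² ≤ 2 · P(ab ∪ ac)² · P(bc)`. -/
theorem gladkov_thm62_of_ne [DecidableEq V] {p : E → ℝ} (hp : IsProb p) {a b c : V}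
    (hab : a ≠ b) (hac : a ≠ c) (hbc : b ≠ c) :
    prob p (G.connEvent a b ∩ G.connEvent b c) ^ 2 ≤
      2 * prob p (G.connEvent a b ∪ G.connEvent a c) ^ 2 * prob p (G.connEvent b c) := by
  set T : Finset V := {b, c} with hT
  have haT : a ∉ T := by simp [hT, hab, hac]
  set t := G.dfs T Finset.univ a [] ∅ with ht
  have hgood := dfs_good_univ (G := G) T haT
  have hallS : DTree.AllS t := allS_dfs T _ _ _ _
  have hproper : DTree.Proper t ∅ := proper_dfs T _ _ _ _ ∅ fun e _ h => h
  set A := G.connEvent a b ∪ G.connEvent a c with hA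
  set M := G.connEvent a b ∩ G.connEvent b c with hM
  set B := G.connEvent b c with hB
  have hAeq : G.reachEvent a T = A := reachEvent_pair a b c
  have hdec : DTree.Decides t ∅ (fun _ => false) A := by rw [← hAeq]; exact hgood.1
  have hM_up : IsUpperSet M := (isUpperSet_connEvent G a b).inter (isUpperSet_connEvent G b c)
  have hA_up : IsUpperSet A := (isUpperSet_connEvent G a b).union (isUpperSet_connEvent G a c)
  have hB_up : IsUpperSet B := isUpperSet_connEvent G b c
  have hAM : A ∩ M = M := Set.inter_eq_right.mpr fun ω hω => Or.inl hω.1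
  -- Theorem 5.2 along the DFS tree: the lower bound
  have hcs := DTree.cauchy_schwarz hp hallS (DTree.continues_refl t) hproper hdec hM_up
  rw [hAM] at hcs
  -- the pointwise inclusion at the leaves
  have hpt : ∀ ω ω' : Config E,
      M.indicator (1 : Config E → ℝ) ω * M.indicator 1 (mix (DTree.run t ω ω') ω ω') ≤
        disjInd A B (DTree.run t ω ω') ω ω' + disjInd B A (DTree.run t ω ω') ω ω' := by
    intro ω ω'
    have h0 : ∀ (X Y : Set (Config E)) (S : Set E), 0 ≤ disjInd X Y S ω ω' := by
      intro X Y S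
      unfold disjInd
      split_ifs <;> norm_num
    by_cases h1 : ω ∈ M
    · by_cases h2 : mix (DTree.run t ω ω') ω ω' ∈ M
      · rw [Set.indicator_of_mem h1, Set.indicator_of_mem h2]
        simp only [Pi.one_apply, mul_one]
        have hleaf := hgood.2.2 ω ω' fun e he => absurd he (Set.notMem_empty e)
        rw [Set.empty_union] at hleaf
        rcases disjOcc_of_leafState hbc hleaf h1 h2 with h | h
        · have : disjInd A B (DTree.run t ω ω') ω ω' = 1 := by unfold disjInd; rw [if_pos h]
          rw [this]; linarith [h0 B A (DTree.run t ω ω')]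
        · have : disjInd B A (DTree.run t ω ω') ω ω' = 1 := by unfold disjInd; rw [if_pos h]
          rw [this]; linarith [h0 A B (DTree.run t ω ω')]
      · rw [Set.indicator_of_notMem h2, mul_zero]
        exact add_nonneg (h0 _ _ _) (h0 _ _ _)
    · rw [Set.indicator_of_notMem h1, zero_mul]
      exact add_nonneg (h0 _ _ _) (h0 _ _ _)
  -- the two-copy sum: Theorem 4.3 twice
  have hsum : ∑ ω, ∑ ω', weight p ω * weight p ω' *
      (M.indicator 1 ω * M.indicator 1 (mix (DTree.run t ω ω') ω ω')) ≤
        prob p A * prob p B + prob p B * prob p A := by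
    calc ∑ ω, ∑ ω', weight p ω * weight p ω' *
          (M.indicator 1 ω * M.indicator 1 (mix (DTree.run t ω ω') ω ω'))
        ≤ ∑ ω, ∑ ω', weight p ω * weight p ω' *
            (disjInd A B (DTree.run t ω ω') ω ω' + disjInd B A (DTree.run t ω ω') ω ω') := by
          refine Finset.sum_le_sum fun ω _ => Finset.sum_le_sum fun ω' _ => ?_
          exact mul_le_mul_of_nonneg_left (hpt ω ω')
            (mul_nonneg (weight_nonneg hp ω) (weight_nonneg hp ω'))
      _ = (∑ ω, ∑ ω', weight p ω * weight p ω' * disjInd A B (DTree.run t ω ω') ω ω') +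
            ∑ ω, ∑ ω', weight p ω * weight p ω' * disjInd B A (DTree.run t ω ω') ω ω' := by
          simp only [mul_add, Finset.sum_add_distrib]
      _ ≤ prob p A * prob p B + prob p B * prob p A :=
          add_le_add (DTree.vdbk hp hproper hA_up hB_up) (DTree.vdbk hp hproper hB_up hA_up)
  calc prob p M ^ 2
      ≤ prob p A * ∑ ω, ∑ ω', weight p ω * weight p ω' *
          (M.indicator 1 ω * M.indicator 1 (mix (DTree.run t ω ω') ω ω')) := hcs
    _ ≤ prob p A * (prob p A * prob p B + prob p B * prob p A) :=
        mul_le_mul_of_nonneg_left hsum (prob_nonneg hp A)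
    _ = 2 * prob p A ^ 2 * prob p B := by ring

/-- **Gladkov's Theorem 6.2, inequality (14)**, for every three vertices. -/
theorem gladkov_thm62 {p : E → ℝ} (hp : IsProb p) (a b c : V) :
    prob p (G.connEvent a b ∩ G.connEvent b c) ^ 2 ≤
      2 * prob p (G.connEvent a b ∪ G.connEvent a c) ^ 2 * prob p (G.connEvent b c) := by
  classical
  have h0 : ∀ X : Set (Config E), 0 ≤ prob p X := prob_nonneg hp
  have h1 : ∀ X : Set (Config E), prob p X ≤ 1 := prob_le_one hp
  by_cases hab : a = b
  · subst hab
    rw [connEvent_self, Set.univ_inter, Set.univ_union, prob_univ]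
    nlinarith [h0 (G.connEvent a c), h1 (G.connEvent a c)]
  by_cases hac : a = c
  · subst hac
    rw [connEvent_self, Set.union_univ, prob_univ, connEvent_comm G b a, Set.inter_self]
    nlinarith [h0 (G.connEvent a b), h1 (G.connEvent a b)]
  by_cases hbc : b = c
  · subst hbc
    rw [connEvent_self, Set.inter_univ, Set.union_self, prob_univ]
    nlinarith [h0 (G.connEvent a b), h1 (G.connEvent a b)]
  exact gladkov_thm62_of_ne hp hab hac hbc

end MultiGraph

/-- **`Gladkov24Thm62` is a theorem**: typer-2's benchmark statement of Gladkov's (14). -/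
theorem Gladkov24Thm62_holds : Gladkov24Thm62 :=
  fun G _ hp a b c => G.gladkov_thm62 hp a b c

end PercRepro
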